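import Literature.NumberTheory.PAdicHodge.BaseGaloisAction
import HarnessLib

/-!
# Ax–Sen–Tate over the base field: `ℂ_F^{Gal(F̄/L)} = \widehat{L}` for `ℚ_p ⊆ L ⊆ F̄`

Continuation of `AxSenTateRelative` and `BaseGaloisAction`. For a non-archimedean local field `F`
of characteristic `0` and residue characteristic `p`, `K₀ = PadicBase F p hp ≅ ℚ_p`,
`F̄ = NormedAlgClosure F`, `ℂ_F = CompletedAlgClosure F`, `G₀ = BaseGaloisGroup hp = Gal(F̄/K₀)`
(acting isometrically on `F̄` and `ℂ_F`) and an ARBITRARY intermediate field `K₀ ⊆ L ⊆ F̄`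
(`L : IntermediateField K₀ F̄`, e.g. `L = ℚ_p(μ_{p^∞})`, which does not contain `F`), we prove Ax's
lemma over `L` for the group `G₀` and

  `{x ∈ ℂ_F | g x = x for all g ∈ G₀ fixing L pointwise} = closure of L in ℂ_F`

(`CompletedAlgClosure.fixedPoints_base_eq_closure`; Ax 1970, main Theorem; Tate 1967 §3.3:
`C^H = \widehat{K_∞}` for `H = Gal(K̄/K_∞)`, the form used in Tate's proof of
`H⁰(G, C(χ)) = 0`). The proofs are those of `AxSenTateRelative` VERBATIM with `Γ_F` replaced by
`G₀` and the base `F` by `K₀`: they only use that the group acts by isometries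
(`BaseGaloisGroup.norm_smul`) and that conjugates over `L` are `G₀`-conjugate by elements fixing
`L` (`BaseGaloisGroup.exists_smul_eq_of_mem_aroots_base`). Since every intermediate field of
`F̄/F` is one of `F̄/K₀` and the `K₀`-automorphisms fixing it are exactly the `F`-automorphisms
fixing it, this version subsumes the one over `F`.

## References

* J. Ax, *Zeros of polynomials over local fields — the Galois action*, J. Algebra 15 (1970),
  417–428. [Ax1970]
* J. Tate, *p-divisible groups* (1967), §3.3. [Tate1967]
* J.-M. Fontaine, Y. Ouyang, *Theory of p-adic Galois representations*, §3.1. [FontaineOuyang2022]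
-/

noncomputable section

open ValuativeRel Field UniformSpace Polynomial

namespace Literature.NumberTheory.PAdicHodge

open Literature.NumberTheory.GaloisRepresentations
open Literature.NumberTheory.GaloisRepresentations.IsNonarchimedeanLocalField

variable {F : Type} [Field F] [ValuativeRel F] [TopologicalSpace F] [IsNonarchimedeanLocalField F]
  [CharZero F] {p : ℕ} [Fact p.Prime]

/-- `‖p‖ < 1` in `F̄` (`p` is the residue characteristic of `F`). [folklore] -/
theorem norm_natCast_base_lt_one (hp : valuation F p < 1) : ‖(p : NormedAlgClosure F)‖ < 1 := by
  rw [PadicBase.norm_natCast_closure hp]; exact PadicBase.norm_p_lt_one hp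

variable (hp : valuation F p < 1)

namespace NormedAlgClosure

/-- Relative form of `norm_smul_sub_le_of_near`: the Galois-deviation bound over `L` passes to
nearby elements. [folklore] -/
theorem norm_smul_sub_le_of_near_base (L : IntermediateField (PadicBase F p hp) (NormedAlgClosure F))
    {α β : NormedAlgClosure F} {D D' : ℝ}
    (hα : ∀ σ : BaseGaloisGroup hp, (∀ y ∈ L, σ • y = y) → ‖σ • α - α‖ ≤ D)
    (hβ : ‖β - α‖ ≤ D') (hDD' : D ≤ D')
    (τ : BaseGaloisGroup hp) (hτ : ∀ y ∈ L, τ • y = y) : ‖τ • β - β‖ ≤ D' := by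
  have h : τ • β - β = τ • (β - α) + ((τ • α - α) + (α - β)) := by
    rw [smul_sub]; abel
  rw [h]
  refine (IsUltrametricDist.norm_add_le_max _ _).trans (max_le ?_ ?_)
  · rw [BaseGaloisGroup.norm_smul]; exact hβ
  · refine (IsUltrametricDist.norm_add_le_max _ _).trans (max_le ((hα τ hτ).trans hDD') ?_)
    rw [norm_sub_rev]; exact hβ

/-- Intermediate fields of `F̄/K₀` have characteristic `0`. [folklore] -/
instance instCharZeroIntermediateFieldBase
    (L : IntermediateField (PadicBase F p hp) (NormedAlgClosure F)) :
    CharZero L :=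
  charZero_of_injective_algebraMap (algebraMap (PadicBase F p hp) L).injective

/-- **The step of Ax's induction over `L`** (as `ax_step`, with the minimal polynomial taken over
the intermediate field `L` and the deviation hypothesis only for `σ ∈ G₀` fixing `L`).
[cite: Ax1970, the Lemma on Δ(α)] -/
theorem ax_step_base (L : IntermediateField (PadicBase F p hp) (NormedAlgClosure F))
    (α : NormedAlgClosure F) {D : ℝ} (hD : 0 ≤ D)
    (hα : ∀ σ : BaseGaloisGroup hp, (∀ y ∈ L, σ • y = y) → ‖σ • α - α‖ ≤ D) {m : ℕ} (hm : 1 ≤ m)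
    (hmn : m < (minpoly L α).natDegree) {k : ℕ} (hk : Nat.log p (minpoly L α).natDegree ≤ k) :
    ∃ β : NormedAlgClosure F, (minpoly L β).natDegree ≤ m ∧
      ‖β - α‖ ≤ D * ‖(p : NormedAlgClosure F)‖ ^ (-((k : ℝ) / m)) := by
  classical
  have hpP : p.Prime := Fact.out
  have hpL : ‖(p : NormedAlgClosure F)‖ < 1 := norm_natCast_base_lt_one hp
  have hint : IsIntegral L α := Algebra.IsIntegral.isIntegral α
  set f : L[X] := minpoly L α with hf
  set n : ℕ := f.natDegree with hn
  have hfmonic : f.Monic := minpoly.monic hint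
  set j : ℕ := n - m with hj
  have hjn : j ≤ n := Nat.sub_le n m
  have hmj : m + j = n := by omega
  have hnj : n - j = m := by omega
  -- the Hasse derivative `g` of order `j`, of degree `m` and leading coefficient `n.choose j`
  set g : L[X] := hasseDeriv j f with hg
  have hgdeg : g.natDegree = m := by rw [hg, natDegree_hasseDeriv, ← hn, hnj]
  have hglead : g.leadingCoeff = (n.choose j : L) := by
    rw [leadingCoeff, hgdeg, hg, hasseDeriv_coeff, hmj]
    have : f.coeff n = 1 := hfmonic.coeff_natDegree
    rw [this, mul_one]
  have hchoose0 : n.choose j ≠ 0 := (Nat.choose_pos hjn).ne'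
  have hg0 : g ≠ 0 := by
    intro h0; rw [h0, natDegree_zero] at hgdeg; omega
  -- base change to `L = F̄` and Taylor expansion at `α`
  set fL : (NormedAlgClosure F)[X] := f.map (algebraMap L (NormedAlgClosure F)) with hfL
  set gL : (NormedAlgClosure F)[X] := g.map (algebraMap L (NormedAlgClosure F)) with hgL
  set q : (NormedAlgClosure F)[X] := taylor α gL with hq
  have hqdeg : q.natDegree = m := by rw [hq, natDegree_taylor, hgL, natDegree_map, hgdeg]
  have hqlead : q.leadingCoeff = (n.choose j : NormedAlgClosure F) := by
    rw [hq, leadingCoeff_taylor, hgL, leadingCoeff_map, hglead, map_natCast]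
  have hq0coeff : q.coeff 0 = (taylor α fL).coeff j := by
    rw [hq, taylor_coeff_zero, hgL, hg, ← hasseDeriv_map, ← taylor_coeff]
  -- `taylor α fL = ∏ (X - C (r - α))` over the roots `r` of `fL`, all of the form `σ • α`
  have hfLmonic : fL.Monic := hfmonic.map _
  have hfLspl : fL.Splits := IsAlgClosed.splits fL
  have hcard : Multiset.card fL.roots = n := by
    rw [← hfLspl.natDegree_eq_card_roots, hfL, natDegree_map]
  have htaylor : taylor α fL = ((fL.roots.map fun r => r - α).map fun δ => X - C δ).prod := by
    conv_lhs => rw [hfLspl.eq_prod_roots_of_monic hfLmonic]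
    rw [taylor_apply, multiset_prod_comp, Multiset.map_map, Multiset.map_map]
    congr 1
    refine Multiset.map_congr rfl fun r _ => ?_
    simp only [Function.comp_apply, sub_comp, X_comp, C_comp, map_sub]
    ring
  have hroots : ∀ δ ∈ fL.roots.map fun r => r - α, ‖δ‖ ≤ D := by
    intro δ hδ
    obtain ⟨r, hr, rfl⟩ := Multiset.mem_map.mp hδ
    obtain ⟨σ, hσL, rfl⟩ := BaseGaloisGroup.exists_smul_eq_of_mem_aroots_base hp L α r (by rwa [aroots_def, ← hfL])
    exact hα σ hσL
  have hcoeff : ‖q.coeff 0‖ ≤ D ^ m := by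
    rw [hq0coeff, htaylor]
    have := norm_coeff_prod_X_sub_C_le (fL.roots.map fun r => r - α) hD hroots j
    rwa [Multiset.card_map, hcard, hnj] at this
  -- a small root `γ` of `q`; `β := γ + α`
  obtain ⟨γ, hγroot, hγ⟩ := exists_isRoot_norm_pow_mul_le q (by rw [hqdeg]; omega)
  rw [hqdeg, hqlead] at hγ
  have hpL0 : 0 < ‖(p : NormedAlgClosure F)‖ := norm_pos_iff.mpr (Nat.cast_ne_zero.mpr hpP.ne_zero)
  have hchooseL : ‖(p : NormedAlgClosure F)‖ ^ k ≤ ‖(n.choose j : NormedAlgClosure F)‖ :=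
    norm_prime_pow_le_norm_natCast hpP hpL hchoose0
      ((Nat.factorization_choose_le_log).trans hk)
  -- `‖γ‖ ≤ D * ‖p‖ ^ (-k/m)`
  set t : ℝ := ‖(p : NormedAlgClosure F)‖ with ht
  set A : ℝ := D * t ^ (-((k : ℝ) / m)) with hA
  have hA0 : 0 ≤ A := mul_nonneg hD (Real.rpow_nonneg hpL0.le _)
  have hm0 : (m : ℝ) ≠ 0 := by exact_mod_cast (show m ≠ 0 by omega)
  have hApow : A ^ m = D ^ m * t ^ (-(k : ℝ)) := by
    rw [hA, mul_pow, ← Real.rpow_natCast (t ^ _) m, ← Real.rpow_mul hpL0.le]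
    congr 2
    field_simp
  have hγm : ‖γ‖ ^ m ≤ A ^ m := by
    rw [hApow]
    have h1 : ‖γ‖ ^ m * t ^ k ≤ D ^ m :=
      (mul_le_mul_of_nonneg_left hchooseL (pow_nonneg (norm_nonneg _) _)).trans (hγ.trans hcoeff)
    have htk : 0 < t ^ k := pow_pos hpL0 k
    rw [Real.rpow_neg hpL0.le, Real.rpow_natCast, ← div_eq_mul_inv, le_div_iff₀ htk]
    exact h1
  have hγA : ‖γ‖ ≤ A := (pow_le_pow_iff_left₀ (norm_nonneg _) hA0 (by omega)).mp hγm
  refine ⟨γ + α, ?_, by rwa [add_sub_cancel_right]⟩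
  -- degree of `β = γ + α` over `F` is at most `deg g = m`
  have hroot : aeval (γ + α) g = 0 := by
    have := hγroot
    rw [IsRoot.def, hq, taylor_eval, hgL, eval_map_algebraMap] at this
    exact this
  have hdeg := minpoly.degree_le_of_ne_zero L (γ + α) hg0 hroot
  calc (minpoly L (γ + α)).natDegree ≤ g.natDegree := natDegree_le_natDegree hdeg
    _ = m := hgdeg


/-- **Ax's lemma over `L`, band form**: if `deg_L α < p^{k+1}` and `‖σ α - α‖ ≤ D` for all
`σ ∈ G₀` fixing `L`, then `‖α - a‖ ≤ ‖p‖^{-c_p(k)} D` for some `a ∈ L`.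
[cite: Ax1970, the Lemma on Δ(α)] [cite: FontaineOuyang2022, §3.1 (Ax–Sen's lemma)] -/
theorem ax_band_base (L : IntermediateField (PadicBase F p hp) (NormedAlgClosure F)) (k : ℕ) :
    ∀ (α : NormedAlgClosure F), (minpoly L α).natDegree < p ^ (k + 1) →
      ∀ {D : ℝ}, 0 ≤ D → (∀ σ : BaseGaloisGroup hp, (∀ y ∈ L, σ • y = y) → ‖σ • α - α‖ ≤ D) →
        ∃ a : L, ‖α - algebraMap L (NormedAlgClosure F) a‖ ≤
          ‖(p : NormedAlgClosure F)‖ ^ (-axExponent p k) * D := by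
  have hpP : p.Prime := Fact.out
  have hpL : ‖(p : NormedAlgClosure F)‖ < 1 := norm_natCast_base_lt_one hp
  have hpL0 : 0 < ‖(p : NormedAlgClosure F)‖ := norm_pos_iff.mpr (Nat.cast_ne_zero.mpr hpP.ne_zero)
  have hone : ∀ e : ℝ, 0 ≤ e → 1 ≤ ‖(p : NormedAlgClosure F)‖ ^ (-e) := fun e he =>
    Real.one_le_rpow_of_pos_of_le_one_of_nonpos hpL0 hpL.le (neg_nonpos.mpr he)
  -- degree-`≤ 1` elements are in `F`
  have hdeg1 : ∀ β : NormedAlgClosure F, (minpoly L β).natDegree ≤ 1 →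
      ∃ a : L, algebraMap L (NormedAlgClosure F) a = β := by
    intro β hβ
    have hint : IsIntegral L β := Algebra.IsIntegral.isIntegral β
    have hpos := minpoly.natDegree_pos hint
    have h1 : (minpoly L β).natDegree = 1 := le_antisymm hβ hpos
    have : β ∈ (algebraMap L (NormedAlgClosure F)).range := by
      rw [← minpoly.natDegree_eq_one_iff]; exact h1
    exact this
  induction k with
  | zero =>
    intro α hn D hD hα
    rw [axExponent_zero, neg_zero, Real.rpow_zero, one_mul]
    rw [zero_add, pow_one] at hn
    have hint : IsIntegral L α := Algebra.IsIntegral.isIntegral α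
    rcases Nat.lt_or_ge 1 (minpoly L α).natDegree with hlt | hle
    · -- degree `n ≥ 2`, `n < p`: one step with `m = 1`, loss exponent `log_p n = 0`
      have hlog : Nat.log p (minpoly L α).natDegree ≤ 0 :=
        (Nat.log_eq_zero_iff.mpr (Or.inl hn)).le
      obtain ⟨β, hβdeg, hβ⟩ := ax_step_base hp L α hD hα le_rfl hlt hlog
      rw [Nat.cast_zero, zero_div, neg_zero, Real.rpow_zero, mul_one] at hβ
      obtain ⟨a, rfl⟩ := hdeg1 β hβdeg
      exact ⟨a, by rwa [norm_sub_rev]⟩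
    · obtain ⟨a, rfl⟩ := hdeg1 α hle
      exact ⟨a, by rw [sub_self, norm_zero]; exact hD⟩
  | succ k ih =>
    intro α hn D hD hα
    rcases Nat.lt_or_ge (minpoly L α).natDegree (p ^ (k + 1)) with hlt | hge
    · -- already in the lower band
      obtain ⟨a, ha⟩ := ih α hlt hD hα
      refine ⟨a, ha.trans (mul_le_mul_of_nonneg_right ?_ hD)⟩
      exact Real.rpow_le_rpow_of_exponent_ge hpL0 hpL.le
        (neg_le_neg (axExponent_mono p (Nat.le_succ k)))
    · -- band `k+1`: step down to degree `≤ p^k` with loss exponent `(k+1)/p^k`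
      have hintα : IsIntegral L α := Algebra.IsIntegral.isIntegral α
      have hlog : Nat.log p (minpoly L α).natDegree ≤ k + 1 :=
        Nat.lt_succ_iff.mp (Nat.log_lt_of_lt_pow (minpoly.natDegree_pos hintα).ne' hn)
      have hm1 : 1 ≤ p ^ k := Nat.one_le_pow _ _ hpP.pos
      have hmn : p ^ k < (minpoly L α).natDegree :=
        lt_of_lt_of_le (Nat.pow_lt_pow_right hpP.one_lt (Nat.lt_succ_self k)) hge
      obtain ⟨β, hβdeg, hβ⟩ := ax_step_base hp L α hD hα hm1 hmn hlog
      set e : ℝ := ((k : ℝ) + 1) / (p : ℝ) ^ k with he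
      have hecast : ((k + 1 : ℕ) : ℝ) / ((p ^ k : ℕ) : ℝ) = e := by
        rw [he]; push_cast; ring
      rw [hecast] at hβ
      have he0 : 0 ≤ e := by positivity
      set D' : ℝ := D * ‖(p : NormedAlgClosure F)‖ ^ (-e) with hD'
      have hDD' : D ≤ D' := le_mul_of_one_le_right hD (hone e he0)
      have hD'0 : 0 ≤ D' := hD.trans hDD'
      have hβ' : ∀ τ : BaseGaloisGroup hp, (∀ y ∈ L, τ • y = y) → ‖τ • β - β‖ ≤ D' :=
        fun τ hτ => norm_smul_sub_le_of_near_base hp L hα hβ hDD' τ hτ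
      have hβlt : (minpoly L β).natDegree < p ^ (k + 1) :=
        lt_of_le_of_lt hβdeg (Nat.pow_lt_pow_right hpP.one_lt (Nat.lt_succ_self k))
      obtain ⟨a, ha⟩ := ih β hβlt hD'0 hβ'
      refine ⟨a, ?_⟩
      have hαa : α - algebraMap L (NormedAlgClosure F) a =
          (α - β) + (β - algebraMap L (NormedAlgClosure F) a) := by abel
      rw [hαa]
      refine (IsUltrametricDist.norm_add_le_max _ _).trans (max_le ?_ ?_)
      · rw [norm_sub_rev]
        refine hβ.trans ?_
        calc D' ≤ ‖(p : NormedAlgClosure F)‖ ^ (-axExponent p k) * D' :=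
              le_mul_of_one_le_left hD'0 (hone _ (axExponent_nonneg p k))
          _ = ‖(p : NormedAlgClosure F)‖ ^ (-axExponent p (k + 1)) * D := by
              rw [hD', axExponent_succ, ← he, neg_add, Real.rpow_add hpL0]; ring
      · refine ha.trans (le_of_eq ?_)
        rw [hD', axExponent_succ, ← he, neg_add, Real.rpow_add hpL0]; ring


/-- **Ax's lemma over an intermediate field `L`** with the uniform constant: for `α ∈ F̄` with
`‖σ α - α‖ ≤ D` for all `σ ∈ G₀` fixing `L` pointwise there is `a ∈ L` with
`‖α - a‖ ≤ ‖p‖^{-(p/(p-1))²} · D`. [cite: Ax1970, the Lemma on Δ(α)]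
[cite: FontaineOuyang2022, §3.1 (Ax–Sen's lemma)] -/
theorem ax_lemma_base (L : IntermediateField (PadicBase F p hp) (NormedAlgClosure F)) (α : NormedAlgClosure F) {D : ℝ} (hD : 0 ≤ D)
    (hα : ∀ σ : BaseGaloisGroup hp, (∀ y ∈ L, σ • y = y) → ‖σ • α - α‖ ≤ D) :
    ∃ a : L, ‖α - algebraMap L (NormedAlgClosure F) a‖ ≤
      ‖(p : NormedAlgClosure F)‖ ^ (-(((p : ℝ) / (p - 1)) ^ 2)) * D := by
  have hpP : p.Prime := Fact.out
  have hpL : ‖(p : NormedAlgClosure F)‖ < 1 := norm_natCast_base_lt_one hp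
  obtain ⟨a, ha⟩ := ax_band_base hp L _ α (Nat.lt_pow_succ_log_self hpP.one_lt _) hD hα
  have hpL0 : 0 < ‖(p : NormedAlgClosure F)‖ :=
    norm_pos_iff.mpr (Nat.cast_ne_zero.mpr hpP.ne_zero)
  refine ⟨a, ha.trans (mul_le_mul_of_nonneg_right ?_ hD)⟩
  exact Real.rpow_le_rpow_of_exponent_ge hpL0 hpL.le (neg_le_neg (axExponent_le hpP.two_le _))

end NormedAlgClosure

/-! ### The fixed field of `Gal(F̄/L)` in `ℂ_F` -/

namespace CompletedAlgClosure

/-- **Ax–Sen–Tate relative to `L`** (Ax 1970, main Theorem; Tate 1967 §3.3; Fontaine–Ouyang §3.1: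
`C^H = \widehat{L}` for `H = Gal(K̄/L)`): for every intermediate field `F ⊆ L ⊆ F̄`, the elements
of `ℂ_F` fixed by every `σ ∈ G₀` fixing `L` pointwise are exactly the topological closure of `L`
in `ℂ_F`. [cite: Ax1970, main Theorem] [cite: Tate1967, §3.3 Theorem 1]
[cite: FontaineOuyang2022, §3.1 (C^H = L̂)] -/
theorem fixedPoints_base_eq_closure (L : IntermediateField (PadicBase F p hp) (NormedAlgClosure F)) :
    {x : CompletedAlgClosure F |
        ∀ σ : BaseGaloisGroup hp, (∀ y ∈ L, σ • y = y) → σ • x = x} =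
      closure ((fun y : NormedAlgClosure F => (y : CompletedAlgClosure F)) ''
        (L : Set (NormedAlgClosure F))) := by
  apply Set.Subset.antisymm
  · -- `⊆`: approximation + Ax's lemma over `L`
    intro x hx
    have hpL : ‖(p : NormedAlgClosure F)‖ < 1 := norm_natCast_base_lt_one hp
    set M : ℝ := ‖(p : NormedAlgClosure F)‖ ^ (-(((p : ℝ) / (p - 1)) ^ 2)) with hM
    have hM0 : 0 ≤ M := Real.rpow_nonneg (norm_nonneg _) _
    rw [Metric.mem_closure_iff]
    intro ε hε
    have hM1 : 0 < M + 1 := by linarith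
    obtain ⟨α, hα⟩ := (denseRange_coe (F := F)).exists_dist_lt x (div_pos hε hM1)
    rw [dist_eq_norm] at hα
    set d : ℝ := ‖x - (α : CompletedAlgClosure F)‖ with hd
    have hdev : ∀ σ : BaseGaloisGroup hp, (∀ y ∈ L, σ • y = y) → ‖σ • α - α‖ ≤ d := by
      intro σ hσ
      rw [← Completion.norm_coe, Completion.coe_sub, ← base_smul_coe]
      have h : σ • (α : CompletedAlgClosure F) - α =
          σ • ((α : CompletedAlgClosure F) - x) + (x - α) := by
        rw [smul_sub, hx σ hσ]; abel
      rw [h]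
      refine (IsUltrametricDist.norm_add_le_max _ _).trans (max_le ?_ le_rfl)
      rw [norm_base_smul, norm_sub_rev]
    obtain ⟨a, ha⟩ := NormedAlgClosure.ax_lemma_base hp L α (norm_nonneg _) hdev
    refine ⟨(algebraMap L (NormedAlgClosure F) a : CompletedAlgClosure F), ⟨_, a.2, rfl⟩, ?_⟩
    rw [dist_eq_norm]
    have hsplit : x - (algebraMap L (NormedAlgClosure F) a : CompletedAlgClosure F) =
        (x - α) + ((α : CompletedAlgClosure F) - algebraMap L (NormedAlgClosure F) a) := by abel
    rw [hsplit]
    refine (IsUltrametricDist.norm_add_le_max _ _).trans_lt (max_lt ?_ ?_)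
    · calc d < ε / (M + 1) := hα
        _ ≤ ε := div_le_self hε.le (by linarith)
    · rw [← Completion.coe_sub, Completion.norm_coe]
      calc ‖α - algebraMap L (NormedAlgClosure F) a‖ ≤ M * d := ha
        _ ≤ (M + 1) * d := mul_le_mul_of_nonneg_right (by linarith) (norm_nonneg _)
        _ < (M + 1) * (ε / (M + 1)) := mul_lt_mul_of_pos_left hα hM1
        _ = ε := mul_div_cancel₀ ε hM1.ne'
  · -- `⊇`: the fixed set is closed and contains `L`
    refine closure_minimal ?_ ?_
    · rintro _ ⟨y, hy, rfl⟩ σ hσ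
      rw [base_smul_coe, hσ y hy]
    · have : {x : CompletedAlgClosure F |
          ∀ σ : BaseGaloisGroup hp, (∀ y ∈ L, σ • y = y) → σ • x = x} =
            ⋂ σ : {σ : BaseGaloisGroup hp // ∀ y ∈ L, σ • y = y},
              {x : CompletedAlgClosure F | σ.1 • x = x} := by
        ext x
        simp only [Set.mem_setOf_eq, Set.mem_iInter, Subtype.forall]
      rw [this]
      exact isClosed_iInter fun σ => isClosed_eq (continuous_base_smul hp σ.1) continuous_id


end CompletedAlgClosure

end Literature.NumberTheory.PAdicHodge

end
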